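import Mathlib.Analysis.InnerProductSpace.Projection.FiniteDimensional
import Mathlib.Analysis.InnerProductSpace.PiL2
import Mathlib.Analysis.InnerProductSpace.Projection.Submodule
import Mathlib.LinearAlgebra.Projection
import Mathlib.LinearAlgebra.FixedSubmodule
import Mathlib.Algebra.Module.Submodule.Invariant
import Mathlib.Data.Finset.NoncommProd
import HarnessLib

/-!
# Fixed spaces of commuting families of unitary operators (the linear algebra of Carlton's proof
# of the Atkin–Lehner Main Lemma, Diamond–Shurman §5.7)

Diamond–Shurman (*A first course in modular forms*, GTM 228, §5.7, pp. 192–195) prove the Main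
Lemma of Atkin–Lehner theory (Thm. 5.7.1) by Carlton's argument: after two reductions the statement
becomes (Thm. 5.7.5, display (5.17))

  `V^H ∩ ∑ᵢ V^{Kᵢ} = ∑ᵢ V^{⟨H, Kᵢ⟩}`,

for the finite group `G = SL₂(ℤ/Nℤ) = ∏ᵢ Gᵢ` acting on `V = S_k(Γ(N))`, with `H = ∏ Hᵢ`, `Hᵢ, Kᵢ ≤ Gᵢ`;
they deduce it (Prop. 5.7.7) from complete reducibility and the tensor-product structure of the
irreducible representations of a product group. This file proves the same inclusion by an
elementary argument which needs neither: for a *finite* group `G` acting linearly on a complex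
vector space `V`, families `a, b : ι → G` such that `aᵢ, bᵢ` commute with `aⱼ, bⱼ` for `i ≠ j`,
and `v ∈ ⋂ᵢ Fix(aᵢ)` of the form `v = ∑ᵢ wᵢ` with `wᵢ ∈ Fix(bᵢ)`, we get
`v = ∑ᵢ uᵢ` with `uᵢ ∈ Fix(bᵢ) ∩ ⋂ⱼ Fix(aⱼ)` (`exists_sum_eq_of_commute`).

Proof (Weyl's unitary trick + commuting idempotents). Average any inner product over `G`, so that
`G` acts by isometries (`exists_core_invariant`). For each `i` put `Aᵢ = Fix(aᵢ)`, `Bᵢ = Fix(bᵢ)`,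
`Cᵢ = Aᵢ ∩ Bᵢ` and let `qᵢ` be the projection onto `Aᵢ` along `Eᵢ = (Bᵢ ∩ Cᵢᗮ) ⊕ (Aᵢ + Bᵢ)ᗮ`
(`isCompl_fixedDecomposition`). Then `qᵢ(Bᵢ) ⊆ Cᵢ`; the subspaces `Aᵢ, Eᵢ` are stable under
`aⱼ, bⱼ` (`j ≠ i`, unitarity: `Fix(u)ᗮ = range(u - 1)`), so `qᵢ` commutes with `aⱼ, bⱼ`, preserves
`Aⱼ, Bⱼ, Eⱼ`, and the `qᵢ` commute pairwise (`LinearMap.IsIdempotentElem.commute_iff`). With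
`P = ∏ⱼ qⱼ`: `v = P v = ∑ᵢ P wᵢ` and `P wᵢ = (∏_{j ≠ i} qⱼ)(qᵢ wᵢ) ∈ Cᵢ ∩ ⋂_{j≠i} Aⱼ`.

The statement is applied in `Literature.NumberTheory.EllipticCurves.NewformsMainLemmaCarltonProofs`
with `G = SL₂(ℤ)/Γ(N)` acting on `S_k(Γ(N))`, `aᵢ` lower unipotent and `bᵢ = T^{-N/pᵢ}`, to prove
Diamond–Shurman Thm. 5.7.1 (`atkinLehnerMainLemma1`).

## Main results (namespace `Literature.LinearAlgebra`)

* `exists_sum_eq_of_isometries` (inner-product form), `exists_core_invariant` (Weyl's trick: a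
  `G`-invariant `InnerProductSpace.Core`), `exists_sum_eq_of_commute_of_finiteDimensional`,
  `exists_sum_eq_of_commute` (finite group acting on any complex vector space; reduction to the
  span of the orbits). Fixed spaces are Mathlib's `LinearMap.fixedSubmodule`.

## References

* F. Diamond, J. Shurman, *A first course in modular forms*, GTM 228, Springer 2005, §5.7
  (Thm. 5.7.5, Prop. 5.7.7, Exercises 5.7.6–5.7.8). doi:10.1007/978-0-387-27226-9
* D. Carlton, *On a result of Atkin and Lehner*, arXiv:math/9910005 (1999).
-/

noncomputable section

open scoped InnerProductSpace ComplexConjugate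
open Module Submodule Function

namespace Literature.LinearAlgebra.FixedSpaces

/-! ### Fixed spaces and invariance under commuting operators -/

section Fixed

variable {R V : Type*} [CommRing R] [AddCommGroup V] [Module R V]

/-- An operator commuting with `u` preserves `Fix(u)` (Mathlib's `LinearMap.fixedSubmodule u`). [folklore] -/
lemma fixedSubmodule_mem_invtSubmodule {u X : Module.End R V} (h : Commute X u) :
    u.fixedSubmodule ∈ Module.End.invtSubmodule X := by
  rw [Module.End.mem_invtSubmodule]
  intro x hx
  rw [Submodule.mem_comap, LinearMap.mem_fixedSubmodule_iff]
  rw [LinearMap.mem_fixedSubmodule_iff] at hx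
  calc u (X x) = (u * X) x := rfl
    _ = (X * u) x := by rw [h.eq]
    _ = X x := by simp [hx]

/-- An operator commuting with `u` preserves `range (u - 1)`. [folklore] -/
lemma range_sub_one_mem_invtSubmodule {u X : Module.End R V} (h : Commute X u) :
    LinearMap.range (u - 1) ∈ Module.End.invtSubmodule X := by
  rw [Module.End.mem_invtSubmodule]
  rintro _ ⟨y, rfl⟩
  rw [Submodule.mem_comap]
  refine ⟨X y, ?_⟩
  have : (u * X) y = (X * u) y := by rw [h.eq]
  simp only [LinearMap.sub_apply, Module.End.one_apply, map_sub, Module.End.mul_apply] at this ⊢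
  rw [this]

/-- A product (`Finset.noncommProd`) of operators each preserving a submodule preserves it. [folklore] -/
lemma mem_invtSubmodule_noncommProd {ι : Type*} (s : Finset ι) (f : ι → Module.End R V) (comm)
    {W : Submodule R V} (hW : ∀ i ∈ s, W ∈ Module.End.invtSubmodule (f i)) :
    W ∈ Module.End.invtSubmodule (s.noncommProd f comm) :=
  Finset.noncommProd_induction s f comm (fun g ↦ W ∈ Module.End.invtSubmodule g)
    (fun g g' hg hg' ↦ by rw [Module.End.mul_eq_comp]; exact Module.End.invtSubmodule.comp _ hg hg')
    (by simp) hW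

/-- A product of operators each fixing `v` fixes `v`. [folklore] -/
lemma noncommProd_apply_eq_self {ι : Type*} (s : Finset ι) (f : ι → Module.End R V) (comm)
    {v : V} (hv : ∀ i ∈ s, f i v = v) : s.noncommProd f comm v = v :=
  Finset.noncommProd_induction s f comm (fun g ↦ g v = v)
    (fun g g' hg hg' ↦ by rw [Module.End.mul_apply, hg', hg]) rfl hv

end Fixed

/-! ### Isometric endomorphisms of a finite-dimensional inner product space -/

section Isometry

variable {V : Type*} [NormedAddCommGroup V] [InnerProductSpace ℂ V] [FiniteDimensional ℂ V]

/-- `u` is isometric: `⟪u x, u y⟫ = ⟪x, y⟫`. For a linear `u` this is equivalent to Mathlib's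
`Isometry ⇑u` (`AddMonoidHomClass.isometry_iff_norm` with `LinearMap.norm_map_iff_inner_map_map`);
it is kept as a file-local predicate because it is exactly what `exists_core_invariant` hands over
for the averaged inner product. [folklore] -/
def IsIsometricEnd (u : Module.End ℂ V) : Prop := ∀ x y : V, ⟪u x, u y⟫_ℂ = ⟪x, y⟫_ℂ

namespace IsIsometricEnd

variable {u : Module.End ℂ V}

omit [FiniteDimensional ℂ V] in
/-- An isometry is injective (cf. Mathlib `Isometry.injective`). [folklore] -/
lemma injective (hu : IsIsometricEnd u) : Function.Injective u := by
  rw [← LinearMap.ker_eq_bot, LinearMap.ker_eq_bot']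
  intro x hx
  have : ⟪x, x⟫_ℂ = 0 := by rw [← hu x x, hx, inner_zero_left]
  exact inner_self_eq_zero.mp this

/-- An isometry preserving a (finite-dimensional) subspace preserves its orthogonal complement. [folklore] -/
lemma orthogonal_mem_invtSubmodule (hu : IsIsometricEnd u) {W : Submodule ℂ V}
    (hW : W ∈ Module.End.invtSubmodule u) : Wᗮ ∈ Module.End.invtSubmodule u := by
  rw [Module.End.mem_invtSubmodule] at hW ⊢
  have hmaps : ∀ x ∈ W, u x ∈ W := fun x hx ↦ hW hx
  have hres : ∀ w ∈ W, ∃ w' ∈ W, u w' = w := by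
    let r : W →ₗ[ℂ] W := u.restrict hmaps
    have hinj : Function.Injective r := by
      intro a b hab
      apply Subtype.ext
      apply hu.injective
      have := congrArg Subtype.val hab
      simpa [r, LinearMap.restrict_apply] using this
    have hsurj : Function.Surjective r := LinearMap.surjective_of_injective hinj
    intro w hw
    obtain ⟨w', hw'⟩ := hsurj ⟨w, hw⟩
    refine ⟨w', w'.2, ?_⟩
    have := congrArg Subtype.val hw'
    simpa [r, LinearMap.restrict_apply] using this
  intro x hx
  rw [Submodule.mem_comap, Submodule.mem_orthogonal]
  intro w hw
  obtain ⟨w', hw', rfl⟩ := hres w hw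
  rw [hu]
  exact Submodule.inner_right_of_mem_orthogonal hw' hx

/-- For an isometry `u` of a finite-dimensional space, `Fix(u)ᗮ = range (u - 1)`. [folklore] -/
lemma orthogonal_fixedSubmodule (hu : IsIsometricEnd u) :
    (u.fixedSubmodule)ᗮ = LinearMap.range (u - 1) := by
  symm
  apply Submodule.eq_of_le_of_finrank_eq
  · rintro _ ⟨y, rfl⟩
    rw [Submodule.mem_orthogonal]
    intro x hx
    rw [LinearMap.mem_fixedSubmodule_iff] at hx
    have h1 : ⟪x, u y⟫_ℂ = ⟪x, y⟫_ℂ := by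
      conv_lhs => rw [← hx]
      exact hu x y
    simp only [LinearMap.sub_apply, Module.End.one_apply, inner_sub_right, h1, sub_self]
  · have h1 := LinearMap.finrank_range_add_finrank_ker (u - 1)
    have h2 := Submodule.finrank_add_finrank_orthogonal u.fixedSubmodule
    have hker : LinearMap.ker (u - 1) = u.fixedSubmodule := by
      rw [LinearMap.fixedSubmodule_eq_ker]; rfl
    rw [hker] at h1
    omega

end IsIsometricEnd

/-! ### The decomposition `V = A ⊕ ((B ∩ Cᗮ) ⊕ (A + B)ᗮ)`, `C = A ∩ B` -/

/-- For subspaces `A, B` of a finite-dimensional inner product space and `C = A ⊓ B`, the subspace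
`E = (B ⊓ Cᗮ) ⊔ (A ⊔ B)ᗮ` is a complement of `A` (Diamond–Shurman §5.7, display (5.19):
`V^{Hᵢ} = Vᵢ₁ ⊕ Vᵢ₂`, `V^{Kᵢ} = Vᵢ₁ ⊕ Vᵢ₃` with `Vᵢ₁ = V^{Hᵢ} ∩ V^{Kᵢ}`, made canonical by
orthogonal complements). [cite: DiamondShurman2005, §5.7 (5.19)] -/
lemma isCompl_fixedDecomposition (A B : Submodule ℂ V) :
    IsCompl A ((B ⊓ (A ⊓ B)ᗮ) ⊔ (A ⊔ B)ᗮ) := by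
  set C := A ⊓ B with hC
  constructor
  · rw [Submodule.disjoint_def]
    intro a ha hE
    obtain ⟨b', hb', d, hd, rfl⟩ := Submodule.mem_sup.mp hE
    have hdAB : d ∈ A ⊔ B := by
      have : b' + d - b' ∈ A ⊔ B :=
        Submodule.sub_mem _ (Submodule.mem_sup_left ha) (Submodule.mem_sup_right hb'.1)
      simpa using this
    have hd0 : d = 0 := Submodule.disjoint_def.mp (Submodule.orthogonal_disjoint (A ⊔ B)) d hdAB hd
    subst hd0
    rw [add_zero] at ha ⊢
    have hCm : b' ∈ C := Submodule.mem_inf.mpr ⟨ha, hb'.1⟩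
    exact Submodule.disjoint_def.mp (Submodule.orthogonal_disjoint C) b' hCm hb'.2
  · rw [codisjoint_iff, eq_top_iff]
    intro x _
    have hx : x ∈ (A ⊔ B) ⊔ (A ⊔ B)ᗮ := by
      rw [Submodule.sup_orthogonal_of_hasOrthogonalProjection]; trivial
    obtain ⟨y, hy, d, hd, rfl⟩ := Submodule.mem_sup.mp hx
    obtain ⟨a, ha, b, hb, rfl⟩ := Submodule.mem_sup.mp hy
    have hB : b ∈ C ⊔ (Cᗮ ⊓ B) := by
      rw [Submodule.sup_orthogonal_inf_of_hasOrthogonalProjection (inf_le_right : C ≤ B)]; exact hb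
    obtain ⟨c, hc, b', hb', rfl⟩ := Submodule.mem_sup.mp hB
    refine Submodule.mem_sup.mpr ⟨a + c, Submodule.add_mem _ ha hc.1, b' + d, ?_, by abel⟩
    exact Submodule.add_mem _ (Submodule.mem_sup_left (Submodule.mem_inf.mpr ⟨hb'.2, hb'.1⟩))
      (Submodule.mem_sup_right hd)

/-- The projection `q` onto `A` along `(B ⊓ Cᗮ) ⊔ (A ⊔ B)ᗮ` maps `B` into `C = A ⊓ B`:
`b = c + (b - c)` with `c` the orthogonal projection of `b` to `C`. [folklore] -/
lemma projection_fixedDecomposition_mem (A B : Submodule ℂ V) {x : V} (hx : x ∈ B) :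
    A.projection _ (isCompl_fixedDecomposition A B) x ∈ A ⊓ B := by
  set C := A ⊓ B with hC
  have hB : x ∈ C ⊔ (Cᗮ ⊓ B) := by
    rw [Submodule.sup_orthogonal_inf_of_hasOrthogonalProjection (inf_le_right : C ≤ B)]; exact hx
  obtain ⟨c, hc, b', hb', rfl⟩ := Submodule.mem_sup.mp hB
  rw [map_add, Submodule.projection_apply_of_mem_left _ hc.1,
    (Submodule.projection_apply_eq_zero_iff _).mpr
      (Submodule.mem_sup_left (Submodule.mem_inf.mpr ⟨hb'.2, hb'.1⟩)), add_zero]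
  exact hc

/-! ### The main linear-algebra statement (inner-product form) -/

/-- **Fixed vectors of commuting isometries** (the linear algebra of Diamond–Shurman Thm. 5.7.5 /
Prop. 5.7.7, elementary form). Let `h i, t i` (`i : ι`) be isometries of a finite-dimensional
complex inner product space such that `h i, t i` commute with `h j, t j` for `i ≠ j`. If
`w i ∈ Fix(t i)` and `v = ∑ w i` is fixed by every `h i`, then `v = ∑ u i` with
`u i ∈ Fix(t i) ∩ ⋂ⱼ Fix(h j)`. [cite: DiamondShurman2005, Thm. 5.7.5 and Prop. 5.7.7 (elementary variant)] -/
theorem exists_sum_eq_of_isometries {ι : Type*} [Fintype ι] [DecidableEq ι]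
    (h t : ι → Module.End ℂ V) (hh : ∀ i, IsIsometricEnd (h i)) (ht : ∀ i, IsIsometricEnd (t i))
    (chh : ∀ i j, i ≠ j → Commute (h i) (h j)) (cht : ∀ i j, i ≠ j → Commute (h i) (t j))
    (ctt : ∀ i j, i ≠ j → Commute (t i) (t j))
    (w : ι → V) (hw : ∀ i, t i (w i) = w i) (hv : ∀ i, h i (∑ j, w j) = ∑ j, w j) :
    ∃ u : ι → V, ∑ i, u i = ∑ i, w i ∧ (∀ i j, h j (u i) = u i) ∧ ∀ i, t i (u i) = u i := by
  classical
  -- the data attached to one index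
  let A : ι → Submodule ℂ V := fun i ↦ (h i).fixedSubmodule
  let B : ι → Submodule ℂ V := fun i ↦ (t i).fixedSubmodule
  let E : ι → Submodule ℂ V := fun i ↦ (B i ⊓ (A i ⊓ B i)ᗮ) ⊔ (A i ⊔ B i)ᗮ
  have hAE : ∀ i, IsCompl (A i) (E i) := fun i ↦ isCompl_fixedDecomposition (A i) (B i)
  let q : ι → Module.End ℂ V := fun i ↦ (A i).projection (E i) (hAE i)
  have hq_idem : ∀ i, IsIdempotentElem (q i) := fun i ↦ Submodule.isIdempotentElem_projection _
  have hq_range : ∀ i, LinearMap.range (q i) = A i := fun i ↦ Submodule.range_projection _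
  have hq_ker : ∀ i, LinearMap.ker (q i) = E i := fun i ↦ Submodule.ker_projection _
  -- (Q1)-(Q3)
  have hQ1 : ∀ i x, x ∈ A i → q i x = x := fun i x hx ↦ Submodule.projection_apply_of_mem_left _ hx
  have hQ2 : ∀ i x, q i x ∈ A i := fun i x ↦ Submodule.projection_apply_mem _ x
  have hQ3 : ∀ i x, x ∈ B i → q i x ∈ A i ⊓ B i := fun i x hx ↦
    projection_fixedDecomposition_mem (A i) (B i) hx
  -- an operator commuting with `h i` and `t i` preserves `A i`, `B i` and `E i`
  have hpres : ∀ i (X : Module.End ℂ V), Commute X (h i) → Commute X (t i) →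
      (A i ∈ Module.End.invtSubmodule X ∧ B i ∈ Module.End.invtSubmodule X ∧
        E i ∈ Module.End.invtSubmodule X) := by
    intro i X hXh hXt
    have hA : A i ∈ Module.End.invtSubmodule X := fixedSubmodule_mem_invtSubmodule hXh
    have hB : B i ∈ Module.End.invtSubmodule X := fixedSubmodule_mem_invtSubmodule hXt
    have hAo : (A i)ᗮ ∈ Module.End.invtSubmodule X := by
      change ((h i).fixedSubmodule)ᗮ ∈ _
      rw [(hh i).orthogonal_fixedSubmodule]
      exact range_sub_one_mem_invtSubmodule hXh
    have hBo : (B i)ᗮ ∈ Module.End.invtSubmodule X := by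
      change ((t i).fixedSubmodule)ᗮ ∈ _
      rw [(ht i).orthogonal_fixedSubmodule]
      exact range_sub_one_mem_invtSubmodule hXt
    have hCo : (A i ⊓ B i)ᗮ ∈ Module.End.invtSubmodule X := by
      have : (A i ⊓ B i)ᗮ = (A i)ᗮ ⊔ (B i)ᗮ := by
        rw [← Submodule.orthogonal_orthogonal (A i), ← Submodule.orthogonal_orthogonal (B i),
          Submodule.inf_orthogonal, Submodule.orthogonal_orthogonal, Submodule.orthogonal_orthogonal,
          Submodule.orthogonal_orthogonal]
      rw [this]
      exact Module.End.invtSubmodule.sup_mem hAo hBo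
    have hABo : (A i ⊔ B i)ᗮ ∈ Module.End.invtSubmodule X := by
      rw [← Submodule.inf_orthogonal]
      exact Module.End.invtSubmodule.inf_mem hAo hBo
    exact ⟨hA, hB, Module.End.invtSubmodule.sup_mem (Module.End.invtSubmodule.inf_mem hB hCo) hABo⟩
  -- hence `q i` commutes with `h j`, `t j` for `j ≠ i`
  have hcomm_q : ∀ i (X : Module.End ℂ V), Commute X (h i) → Commute X (t i) → Commute (q i) X := by
    intro i X hXh hXt
    obtain ⟨hA, -, hE⟩ := hpres i X hXh hXt
    rw [LinearMap.IsIdempotentElem.commute_iff (hq_idem i), hq_range, hq_ker]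
    exact ⟨hA, hE⟩
  have hqh : ∀ i j, i ≠ j → Commute (q i) (h j) := fun i j hij ↦
    hcomm_q i (h j) (chh j i hij.symm) ((cht j i hij.symm))
  have hqt : ∀ i j, i ≠ j → Commute (q i) (t j) := fun i j hij ↦
    hcomm_q i (t j) ((cht i j hij).symm) (ctt j i hij.symm)
  -- and the `q i` commute pairwise and preserve each other's `A`, `B`
  have hqq : ∀ i j, i ≠ j → Commute (q i) (q j) := fun i j hij ↦
    (hcomm_q j (q i) (hqh i j hij) (hqt i j hij)).symm
  have hqA : ∀ i j, i ≠ j → A i ∈ Module.End.invtSubmodule (q j) := fun i j hij ↦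
    (hpres i (q j) (hqh j i hij.symm) (hqt j i hij.symm)).1
  have hqB : ∀ i j, i ≠ j → B i ∈ Module.End.invtSubmodule (q j) := fun i j hij ↦
    (hpres i (q j) (hqh j i hij.symm) (hqt j i hij.symm)).2.1
  -- the product `P = ∏ q j`
  have hcommS : ((Finset.univ : Finset ι) : Set ι).Pairwise (Commute on q) :=
    fun i _ j _ hij ↦ hqq i j hij
  have hcommE : ∀ i, ((Finset.univ.erase i : Finset ι) : Set ι).Pairwise (Commute on q) :=
    fun i a _ b _ hab ↦ hqq a b hab
  have hcommE : ∀ i, ((Finset.univ.erase i : Finset ι) : Set ι).Pairwise (Commute on q) :=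
    fun i a _ b _ hab ↦ hqq a b hab
  let P : Module.End ℂ V := Finset.univ.noncommProd q hcommS
  have hPv : P (∑ j, w j) = ∑ j, w j :=
    noncommProd_apply_eq_self _ q hcommS fun i _ ↦ hQ1 i _ (by
      simpa [A, LinearMap.mem_fixedSubmodule_iff] using hv i)
  have hPA : ∀ j x, P x ∈ A j := by
    intro j x
    show Finset.univ.noncommProd q hcommS x ∈ A j
    rw [← Finset.mul_noncommProd_erase (Finset.univ : Finset ι) (Finset.mem_univ j) q hcommS,
      Module.End.mul_apply]
    exact hQ2 j _
  have hPC : ∀ i, P (w i) ∈ A i ⊓ B i := by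
    intro i
    show Finset.univ.noncommProd q hcommS (w i) ∈ A i ⊓ B i
    rw [← Finset.noncommProd_erase_mul (Finset.univ : Finset ι) (Finset.mem_univ i) q hcommS,
      Module.End.mul_apply]
    have hmem : q i (w i) ∈ A i ⊓ B i := hQ3 i _ (by
      simpa [B, LinearMap.mem_fixedSubmodule_iff] using hw i)
    have hinv : (A i ⊓ B i) ∈ Module.End.invtSubmodule
        ((Finset.univ.erase i).noncommProd q (hcommE i)) :=
      mem_invtSubmodule_noncommProd _ q _ fun j hj ↦
        Module.End.invtSubmodule.inf_mem (hqA i j (Finset.ne_of_mem_erase hj).symm)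
          (hqB i j (Finset.ne_of_mem_erase hj).symm)
    exact (Module.End.mem_invtSubmodule _).mp hinv hmem
  refine ⟨fun i ↦ P (w i), ?_, ?_, ?_⟩
  · rw [← map_sum, hPv]
  · intro i j
    exact LinearMap.mem_fixedSubmodule_iff.mp (hPA j (w i))
  · intro i
    exact LinearMap.mem_fixedSubmodule_iff.mp (hPC i).2

end Isometry

/-! ### Weyl's unitary trick and the statement for a finite group acting linearly -/

section Weyl

variable {G : Type*} [Group G] [Finite G]

/-- **Weyl's unitary trick**: a finite group acting linearly on a finite-dimensional complex vector
space preserves some inner product (average any inner product over the group). The tree's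
`Literature/RepresentationTheory/CompactGroups/UnitaryTrick.lean` has the compact-group version in
matrix form (`exists_isUnit_conj_mem_unitaryGroup`); this is the lighter `InnerProductSpace.Core`
form on an abstract space for a finite group, which is what `exists_sum_eq_of_isometries` consumes. [folklore] -/
theorem exists_core_invariant {V : Type*} [AddCommGroup V] [Module ℂ V] [FiniteDimensional ℂ V]
    (ρ : G →* Module.End ℂ V) :
    ∃ c : InnerProductSpace.Core ℂ V, ∀ g x y, c.inner (ρ g x) (ρ g y) = c.inner x y := by
  classical
  haveI := Fintype.ofFinite G
  let d := Module.finrank ℂ V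
  let E : V ≃ₗ[ℂ] EuclideanSpace ℂ (Fin d) :=
    (Module.finBasis ℂ V).equivFun.trans (EuclideanSpace.equiv (Fin d) ℂ).symm.toLinearEquiv
  let ip : V → V → ℂ := fun x y ↦ ∑ g, ⟪E (ρ g x), E (ρ g y)⟫_ℂ
  refine ⟨{ inner := ip
            conj_inner_symm := ?_
            re_inner_nonneg := ?_
            add_left := ?_
            smul_left := ?_
            definite := ?_ }, ?_⟩
  · intro x y
    simp only [ip, map_sum, inner_conj_symm]
  · intro x
    change 0 ≤ RCLike.re (∑ g, ⟪E (ρ g x), E (ρ g x)⟫_ℂ)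
    rw [map_sum]
    exact Finset.sum_nonneg fun g _ ↦ inner_self_nonneg (𝕜 := ℂ)
  · intro x y z
    simp only [ip, map_add, inner_add_left, Finset.sum_add_distrib]
  · intro x y r
    simp only [ip, map_smul, inner_smul_left, Finset.mul_sum]
  · intro x hx
    have hre : ∑ g, RCLike.re ⟪E (ρ g x), E (ρ g x)⟫_ℂ = 0 := by
      have := congrArg RCLike.re hx
      simpa only [ip, map_sum, map_zero] using this
    have h1 : RCLike.re ⟪E (ρ 1 x), E (ρ 1 x)⟫_ℂ = 0 :=
      (Finset.sum_eq_zero_iff_of_nonneg fun g _ ↦ inner_self_nonneg).mp hre 1 (Finset.mem_univ _)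
    rw [map_one, Module.End.one_apply, inner_self_eq_norm_sq, sq_eq_zero_iff, norm_eq_zero] at h1
    simpa using h1
  · intro g x y
    change ∑ g', ⟪E (ρ g' (ρ g x)), E (ρ g' (ρ g y))⟫_ℂ = ∑ g', ⟪E (ρ g' x), E (ρ g' y)⟫_ℂ
    simp only [← Module.End.mul_apply, ← map_mul]
    exact Fintype.sum_equiv (Equiv.mulRight g) _ _ fun _ ↦ rfl

/-- **Fixed vectors of commuting elements of a finite group** (finite-dimensional case): for a
finite group `G` acting linearly on a finite-dimensional complex vector space, `a i, b i ∈ G` with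
`a i, b i` commuting with `a j, b j` for `i ≠ j`, `w i ∈ Fix(b i)` and `∑ w i` fixed by all `a i`,
there are `u i ∈ Fix(b i) ∩ ⋂ⱼ Fix(a j)` with `∑ u i = ∑ w i` (Weyl's trick and
`exists_sum_eq_of_isometries`). [cite: DiamondShurman2005, Thm. 5.7.5 and Prop. 5.7.7 (elementary variant)] -/
theorem exists_sum_eq_of_commute_of_finiteDimensional {V : Type*} [AddCommGroup V] [Module ℂ V]
    [FiniteDimensional ℂ V] (ρ : G →* Module.End ℂ V) {ι : Type*} [Fintype ι] [DecidableEq ι]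
    (a b : ι → G) (haa : ∀ i j, i ≠ j → Commute (a i) (a j))
    (hab : ∀ i j, i ≠ j → Commute (a i) (b j)) (hbb : ∀ i j, i ≠ j → Commute (b i) (b j))
    (w : ι → V) (hw : ∀ i, ρ (b i) (w i) = w i) (hv : ∀ i, ρ (a i) (∑ j, w j) = ∑ j, w j) :
    ∃ u : ι → V, ∑ i, u i = ∑ i, w i ∧ (∀ i j, ρ (a j) (u i) = u i) ∧ ∀ i, ρ (b i) (u i) = u i := by
  obtain ⟨c, hc⟩ := exists_core_invariant ρ
  letI : NormedAddCommGroup V := @InnerProductSpace.Core.toNormedAddCommGroup ℂ V _ _ _ c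
  letI : InnerProductSpace ℂ V := InnerProductSpace.ofCore c.toCore
  exact exists_sum_eq_of_isometries (fun i ↦ ρ (a i)) (fun i ↦ ρ (b i))
    (fun i x y ↦ hc (a i) x y) (fun i x y ↦ hc (b i) x y)
    (fun i j hij ↦ (haa i j hij).map ρ) (fun i j hij ↦ (hab i j hij).map ρ)
    (fun i j hij ↦ (hbb i j hij).map ρ) w hw hv

/-- **Fixed vectors of commuting elements of a finite group**: for a finite group `G` acting
linearly on a complex vector space `V`, `a i, b i ∈ G` (`i : ι`, finite) with `a i, b i` commuting
with `a j, b j` for `i ≠ j`, `w i ∈ Fix(b i)` and `∑ w i` fixed by every `a i`, there are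
`u i ∈ Fix(b i) ∩ ⋂ⱼ Fix(a j)` with `∑ u i = ∑ w i`. (Reduction to the finite-dimensional span of the
`G`-orbits of the `w i`.) This is the form in which the linear algebra of Diamond–Shurman Thm. 5.7.5
enters the proof of the Main Lemma. [cite: DiamondShurman2005, Thm. 5.7.5 and Prop. 5.7.7 (elementary variant)] -/
theorem exists_sum_eq_of_commute {V : Type*} [AddCommGroup V] [Module ℂ V]
    (ρ : G →* Module.End ℂ V) {ι : Type*} [Fintype ι] [DecidableEq ι]
    (a b : ι → G) (haa : ∀ i j, i ≠ j → Commute (a i) (a j))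
    (hab : ∀ i j, i ≠ j → Commute (a i) (b j)) (hbb : ∀ i j, i ≠ j → Commute (b i) (b j))
    (w : ι → V) (hw : ∀ i, ρ (b i) (w i) = w i) (hv : ∀ i, ρ (a i) (∑ j, w j) = ∑ j, w j) :
    ∃ u : ι → V, ∑ i, u i = ∑ i, w i ∧ (∀ i j, ρ (a j) (u i) = u i) ∧ ∀ i, ρ (b i) (u i) = u i := by
  classical
  haveI := Fintype.ofFinite G
  let S : Submodule ℂ V := Submodule.span ℂ (Set.range fun p : G × ι ↦ ρ p.1 (w p.2))
  haveI : FiniteDimensional ℂ S := FiniteDimensional.span_of_finite ℂ (Set.finite_range _)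
  have hS : ∀ g, ∀ x ∈ S, ρ g x ∈ S := by
    intro g
    have : S ∈ Module.End.invtSubmodule (ρ g) := by
      rw [Module.End.mem_invtSubmodule, Submodule.span_le]
      rintro _ ⟨⟨g', i⟩, rfl⟩
      simp only [SetLike.mem_coe, Submodule.mem_comap]
      refine Submodule.subset_span ⟨⟨g * g', i⟩, ?_⟩
      simp only [map_mul, Module.End.mul_apply]
    exact fun x hx ↦ (Module.End.mem_invtSubmodule _).mp this hx
  let ρS : G →* Module.End ℂ S :=
    { toFun := fun g ↦ (ρ g).restrict (hS g)
      map_one' := by ext x; simp [LinearMap.restrict_apply]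
      map_mul' := fun g g' ↦ by ext x; simp [LinearMap.restrict_apply] }
  have hwS : ∀ i, w i ∈ S := fun i ↦ Submodule.subset_span ⟨⟨1, i⟩, by simp⟩
  let wS : ι → S := fun i ↦ ⟨w i, hwS i⟩
  have hsum : ((∑ j, wS j : S) : V) = ∑ j, w j := by simp [wS]
  obtain ⟨u, hu, hua, hub⟩ := exists_sum_eq_of_commute_of_finiteDimensional ρS a b haa hab hbb wS
    (fun i ↦ Subtype.ext (by simpa [ρS, wS, LinearMap.restrict_apply] using hw i))
    (fun i ↦ Subtype.ext (by
      simp only [ρS, MonoidHom.coe_mk, OneHom.coe_mk, LinearMap.restrict_apply, hsum]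
      exact hv i))
  refine ⟨fun i ↦ (u i : V), ?_, ?_, ?_⟩
  · have := congrArg Subtype.val hu
    simpa [hsum] using this
  · intro i j
    have := congrArg Subtype.val (hua i j)
    simpa [ρS, LinearMap.restrict_apply] using this
  · intro i
    have := congrArg Subtype.val (hub i)
    simpa [ρS, LinearMap.restrict_apply] using this

end Weyl

end Literature.LinearAlgebra.FixedSpaces
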